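import Mathlib
import HarnessLib
import HarnessLib.Audit
import Summits.KontsevichZagierPeriods.Statement
import Summits.KontsevichZagierPeriods.KontsevichZagierPeriods.Theorems.GrothendieckGpcLegendreLemniscatic
import HarnessLib.Audit.Status.Attr

/-!
Route: VeryGoodTransfer

DORMANT since 2026-08-23T17:01:07Z (reconciler: no traction for 6.1 d (last activity item-proof-filed at 2026-08-17T13:07:45Z); parked, not closed — `ledger route dormant route-KontsevichZagierPeriods-VeryGoodTransfer --off` to reactiva) — unstaffed, not closed; items shared with open routes are served there. `ledger route dormant <id> --off` reactivates.

# Route VeryGoodTransfer — very good pairs are top-degree: reduce Conjecture 1 inside the rules to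
its ℚ-coefficient kernel form on the RESOLVED sector, and derive that from Kontsevich's formal
period conjecture by a cellwise Nori-to-KZ transfer typed free-abelian-to-ℚ̄

It suffices to show X = ResolvedRepsKernel (ledger record 7967, the target since the 2026-08-15
gen-2
repair): every ℤ-combination c of integral representations from the RESOLVED sector — bounded
ℚ-semialgebraic domain,
integrand C¹ on an open neighbourhood of the closure of the domain, any dimensions — with KZ.eval c
= 0 has a non-zero
integer multiple in KZ.relations (Conjecture 1 in kernel form with ℚ-coefficients, on the sector
where every integral is
a naive period of a smooth affine pair). FRAME (deciding theorem `closes`, PROVED, 30 lines of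
subgroup algebra over the
soundness theorem `Literature.NumberTheory.Transcendental.KZ.relations_le_ker_eval_holds`):
RationalRepsResolve (N, crux
rank 4: every representation of KZ's rational shape resolves INSIDE THE RULES into the sector) →
ResolvedRepsKernel (X) →
TorsionFree (T, support: P_KZ = FormalRep ⧸ relations is torsion-free) → KontsevichZagierPeriods.
LINE OF ATTACK on X
(card very-good-pairs-are-top-degree, spine): for the CLASSICAL period datum over ℚ̄
(`Literature.AlgebraicGeometry.Motives.ClassicalPeriodDatum`, landed) three things give X — (FPC)
Kontsevich's formal
period conjecture for that datum — injectivity of the evaluation of effective formal periods, the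
Sweep1-module predicate,
deliberately not named verbatim in this header: it is OPEN, load-bearing, enters only as the
conjecture ITEM FPCClassical of the
split of X and never as a Literature fact (≡ Grothendieck's period conjecture for Nori motives,
HuberMullerStachPeriods2017 §13.2); (Φ) the cellwise very-good
TRANSFER Φ : 𝒫̃⁺ → P_KZ ⊗_{k_ℝ} ℚ̄ killing every formal-period relator, built cell by cell on very
good pairs
(HuberMullerStachPeriodsIII2015 Cor. 12.1.6(1): generators AND relations of 𝒫̃⁺ come from very good
pairs, so only
bilinearity and the two TOP-DEGREE edge types (F) f^*, (B) ∂/δ must be transferred —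
CellwiseVGoodTransfer, the designated
rank-2 CHILD of X: informal text, grounding and the crux-attack record (verdict SURVIVES, candidate
typing Probe.lean) live on
ledger record 6300 (closed moot at the gen-4 drop; evidence kept there); it is not an item of this
route until it can be typed faithfully, see NOT
DECOMPOSED YET (i));
(Ψ) the SECTION on the resolved sector, a `Literature.NumberTheory.Transcendental.KZ.NoriSymbolData`
with Φ ∘ Ψ = (· ⊗ 1)
(its H21 half is N). Then eval c = 0 ⇒ ev (Ψ c) = 0 ⇒ Ψ c ∈ formal relations (FPC) ⇒ c ⊗ 1 = Φ (Ψ c)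
= 0 ⇒ m • c ∈
KZ.relations, which is X (cf. the tree's
`Literature.NumberTheory.Transcendental.KZ.kernel_subset_relations_of_isFaithful`,
the same assembly with faithfulness in place of Φ). Both maps are typed in the only direction an
additive map can exist
(free abelian group → ℚ̄-space for Ψ, 𝒫̃⁺ → P_KZ ⊗ ℚ̄ for Φ, torsion discharged by T), so
`Summit.KontsevichZagierPeriods.NoriTransfer.no_additive_transfer_section` does not apply. FILE
DISCIPLINE (gen-2 repair, reason
corrected by the gen-4 repair 2026-08-15): the route file is stated over the KZ calculus alone and
the motivic layer (FPC, Φ, Ψ)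
enters as the glued split of X later. Not because of imports: under the constant-level staffability
rule (HarnessLib.Audit
`#h21_route_deps`, human rule 2026-08-15) a decl typed over `ClassicalPeriodDatum` was MEASURED to
add no unproved fact to the cone
(gate-native preview of the candidate typing: 227 project constants; closed Prop facts = the summit,
the summit's own conjecture constant via the
statement, and the route's own items; the OPEN standard conjectures of Motives/Correspondences.lean
are in the module import cone but
are reached by no constant). The real obstruction is the INTERFACE: `ClassicalPeriodDatum` posits
the class map `formClass` without its
kernel, so a transfer Φ normalised on every presentation of a de Rham CLASS must be
presentation-independent across a kernel the KZ
moves cannot see in a junk model — such a ∀𝒞-statement is summit-implied (hence irrefutable) yet not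
provable by the mechanism, the
worst kind of served item; an ∃𝒞-statement asks for a construction of algebraic de Rham cohomology.
Re-entry condition: the interface
carries, as FIELDS, the de Rham kernel on smooth affine pairs (periods over semialgebraic relative
cycles detect relative exactness of
presented top forms), very-good generation (HuberMullerStachPeriods2017 Cor. 13.1.7(1)) and, for
singular very good vertices, excision
+ Čech presentation with their period formula (definition request (4)); then `route edit --split
ResolvedRepsKernel`. needs-fact: none
(no standard conjecture, no Literature fact is used by any item; cone 27 constants, 0 unproved).
Lean: `∀ c ∈ AddSubgroup.closure {x : Literature.NumberTheory.Transcendental.KZ.FormalRep | ∃ (n :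
ℕ) (ρ : Literature.NumberTheory.Transcendental.KZ.IntegralRep n), Bornology.IsBounded ρ.domain ∧ (∃
U : Set (Fin n → ℝ), IsOpen U ∧ closure ρ.domain ⊆ U ∧ ContDiffOn ℝ 1 ρ.integrand U) ∧ x =
Literature.NumberTheory.Transcendental.KZ.of ρ}, Literature.NumberTheory.Transcendental.KZ.eval c =
0 → ∃ m : ℕ, m ≠ 0 ∧ m • c ∈ Literature.NumberTheory.Transcendental.KZ.relations`

## Assembly
Deciding theorem (glue.lean, certified by `ledger route check --native`; axioms propext /
Classical.choice / Quot.sound):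
`theorem closes (h₁ : RationalRepsResolve) (h₂ : ResolvedRepsKernel) (h₃ : TorsionFree) :
KontsevichZagierPeriods` — for
rational r, r′ with r.value = r′.value take resolutions [r] − S, [r′] − S′ ∈ KZ.relations (N); S −
S′ lies in the resolved
sector and KZ.eval (S − S′) = 0 by soundness of the moves; X gives m • (S − S′) ∈ relations with m ≠
0, T gives S − S′ ∈
relations, and [r] − [r′] = ([r] − S) + (S − S′) − ([r′] − S′). The Assembly item records the same
implication
`RationalRepsResolve → ResolvedRepsKernel → TorsionFree → KontsevichZagierPeriods` (provable now:
`fun h₁ h₂ h₃ => closes h₁ h₂ h₃`).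

Rationale: WHY THIS LINE. Mechanism (eval = per ∘ Ψ, transfer Φ back): by HuberMullerStachPeriodsIII2015 Cor.
12.1.6(1) (= HuberMullerStachPeriods2017 Cor. 13.1.7(1); draft p. 31 read by the opener)
generators AND relations of the effective formal period space 𝒫̃⁺ may be restricted to VERY GOOD
pairs (X affine of dimension d, D of dimension
d−1, X∖D smooth, cohomology in degree d only), so the relations to transfer are bilinearity plus two
TOP-DEGREE edge types — (F) f^* between
very good pairs of equal dimension and (B) ∂/δ for very good triples — which have exactly the shape
of the H21 rules (Nori's basic lemma,
diagram periods = periods of the diagram category, draft Thm. 7.4.21 + 8.2.20; no Tannakian duality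
and no (2πi)^{-1}, unlike Ayoub2015 /
AyoubRelKZRevisited Rem. 1.3). The transfer Φ : 𝒫̃⁺ → P_KZ × P_KZ (real and imaginary parts; P_KZ =
FormalRep ⧸ relations, k_ℝ = ℚ̄ ∩ ℝ acting by integrand scaling,
support AlgebraicScalingActsOnRelations) presents a symbol by strict C^p-triangulated
ℚ-semialgebraic chains (CzaplaPawlucki2018,
Pawlucki2023) and pulled-back polynomial forms; Stokes on a simplex is d Newton–Leibniz moves
because the simplex is a band in every
coordinate direction (supports NewtonLeibnizAnyCoordinate, StokesSimplexVanishingBoundary)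
(per-direction L¹ automatic for
C^{p−1} coefficients on the closed simplex). What survives of HuberMullerStachPeriodsIII2015 Rem.
12.1.7 (= 2017 Rem. 13.1.8; Rem. 9.4.4:
even P⁺ = P⁺_nc is open to the authors) is located precisely: de Rham classes on SINGULAR very good
vertices are hypercohomology
classes, not global forms — and the H21 calculus sidesteps this because a KZ representation, unlike
a period symbol, carries no cohomology
class: a singular vertex is presented through a resolution and an affine Čech cover cell by cell,
the correction cells being naive
integrals of regular forms on smooth affines in lower dimension (CellwiseVGoodTransfer — the
designated rank-2 child of X, ledger
record 6300, re-sited from the item roster to the TWO-LAYER PLAN by the gen-4 repair). The FRAME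
around the mechanism is
CressonViusos2022's (Thm. 2.1: a sector conjecture on compact domains implies KZ) made internal to
the rules: RationalRepsResolve (ViuSos2021
Thm. 1.1 / Cor. 2.2 "respecting the KZ-rules", here as actual move chains) puts both given
representations in the resolved sector, where
every integral IS a naive period of a smooth affine pair (HuberMullerStachPeriodsIII2015 Lemma
11.2.3), the target ResolvedRepsKernel is
Conjecture 1 with ℚ-coefficients there, and TorsionFree removes the coefficients; the deciding
theorem `closes` (N → X → T → summit) is
proved. Imported areas: Nori motives / diagram periods (algebraic geometry) for the reduction of
relations; o-minimal and real algebraic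
geometry (strict C^p triangulation, Hardt triviality, Hironaka1964 resolution, BochnakCosteRoy1998)
for presentations and for N; no
transcendence anywhere — it all sits in FPC. Versus prior routes: NoriTransfer (closed, refuted as
typed) posited an additive
Φ : FreePeriodSymbols →+ FormalRep, which cannot exist (`no_additive_transfer_section`); the gen-1
target KZTransferPackage (dropped) was
summit ∧ FPC as typed (refuter's Lean finding on record 5088); the present X is summit-strength only
on the resolved sector, over KZCalculus.

RANKED CRUXES. #0 ResolvedRepsKernel (target) — X as in § Thesis: kernel form of Conjecture 1 with
ℚ-coefficients on the closure of the
resolved generators (bounded domain, integrand C¹ on a neighbourhood of the closure). (why it might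
fail: period-conjecture strength on the
sector — false as soon as one motivic relation among bounded C¹ integrals, e.g. a (B)-edge through a
singular very good vertex (HMS Rem.
13.1.8), is no finite chain of absolutely convergent moves.) [KontsevichZagier2001, Kontsevich1999,
HuberMullerStachPeriodsIII2015,
HuberMullerStachPeriods2017, ViuSos2021, CressonViusos2022]
#2 — VACANT in the file (gen-4 repair): the hardest step, the cellwise transfer Φ =
CellwiseVGoodTransfer (for the classical datum
over ℚ̄ an additive Φ : FreePeriodSymbols R σ → P_KZ × P_KZ killing the span of the six
IsFormalPeriodRelator constructors, normalised on
presented smooth affine symbols by Φ[(X,D,[ω],[Γ])] = (Σ_c [Δ^d, m_c·Re φ_c^*ω], Σ_c [Δ^d, m_c·Im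
φ_c^*ω]); very good symbols, bilinearity,
edges (F), (B); singular very good vertices through a resolution + affine Čech cover, cell by cell;
why it might fail: the (B) edge of a
very good triple mixes three cellwise presentations with no common resolution (π|_Ỹ not birational)
— chain-level descent along a
2-truncated proper hypercover, every homotopy a finite chain of ABSOLUTELY CONVERGENT move
instances; sources on ledger record 6300; XL) is by D-0019 the layer-2 CHILD of #0, installed by
`--split ResolvedRepsKernel` once typable faithfully (NOT DECOMPOSED YET (i)). Carried until gen-4
as the
informal ledger record 6300 (grounded g15-21; crux attack 2026-08-15: SURVIVES, evidence on the
item) and re-sited: an informal crux that is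
no hypothesis of `closes` and has no faithful typing does not belong in the roster (the split child
would duplicate it). Staffing keys
on #3/#4 until then.
#3 LegendreCompiled (crux, shared with route Grothendieck item 0280) — end-to-end instance of the
mechanism: Legendre's relation at the
lemniscatic modulus, 2EK − K² = π/2, as ONE 2-dimensional semialgebraic representation on (0,1)²
versus ∫_ℝ dx/(2(1+x²)), is a KZ
equivalence — to be obtained by COMPILING its motivic proof (cup product H¹⊗H¹ → H²(E) ≅ ℚ(−1)
written as Pairs^eff edges on E, E×E,
ℙ¹) through the cellwise recipe; the complete curve E forces the Čech presentation of second-kind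
forms (no global form), the smallest
case where the rank-2 mechanism is exercised. (why it might fail: every printed proof deforms the
modulus or uniformises; compiling the
cup product needs Stokes on semialgebraic 2- and 3-chains in E×E(ℂ) ⊂ ℝ⁸ with second-kind forms
whose poles at ∞ must stay off every
intermediate chain.) [Chudnovsky1976, HuberWustholz2022, KontsevichZagier2001,
HuberMullerStachPeriods2017, Andre2004] [difficulty: L]
#4 RationalRepsResolve (crux) — resolution of singularities inside the rules (the H21 half of the
section Ψ; hypothesis N of `closes`):
every representation of KZ's rational shape is move-equivalent to a ℤ-combination of representations
of the same dimension with
BOUNDED domain and integrand C¹ on an open neighbourhood of the closure of the domain — by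
cylindrical decomposition, blow-up charts of a
ℚ-resolution used as change-of-variables moves on open cells, and the HMS monomial argument
"absolute convergence ⇒ exponents ≥ 0"
(draft Lemma 11.2.2). (why it might fail: each compactification or blow-up chart must be ONE
changeOfVariablesRel instance — injective,
derivative within the cell, ℚ-semialgebraic — after domain-additivity cuts, and x ↦ 1/x charts
create boundary poles the monomial
argument must again remove.) [ViuSos2021, arXiv:1509.01097, HuberMullerStachPeriodsIII2015,
BelkaleBrosnan2003, Hironaka1964,
BochnakCosteRoy1998, KontsevichZagier2001] [difficulty: L]
#9 TorsionFree (support, shared with CoactionDevissage item 3169; hypothesis T of `closes`) — n ≠ 0,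
n • c ∈ KZ.relations ⇒ c ∈
KZ.relations, by the slab argument (c − c·[0,1], n slabs + translations,
`KZ.mul_mem_relations_right_holds`). [provable-now]
[KontsevichZagier2001]
#9 NewtonLeibnizAnyCoordinate (support) — rule (3) along an ARBITRARY coordinate j of ℝⁿ⁺¹ is a
relation (coordinate-permutation change
of variables, |det| = 1, then the fixed last-coordinate move). [provable-now] [KontsevichZagier2001,
HuberMullerStachPeriods2017]
#9 StokesSimplexVanishingBoundary (support) — Lemma S on the open standard simplex with boundary
values zero: Σ_j ∂_jη_j integrates to a
relation (d+1 Newton–Leibniz moves + additivity); the engine of presentation-independence. [M]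
[KontsevichZagier2001, CzaplaPawlucki2018,
Pawlucki2023]
#9 AlgebraicScalingActsOnRelations (support; candidate proof VGT5092.lean attached by grounder
g15-21) — the k_ℝ-module structure of P_KZ.
[provable-now] [KontsevichZagier2001, HuberMullerStachPeriods2017]
#1 Assembly — RationalRepsResolve → ResolvedRepsKernel → TorsionFree → KontsevichZagierPeriods (=
the certified `closes`; provable now).

TWO-LAYER PLAN. X = ResolvedRepsKernel ⇐ FPCClassical → CellwiseVGoodTransfer → ResolvedSection →
ResolvedRepsKernel (k = 3): FPCClassical :=
the Sweep1 formal-period-injectivity predicate at (𝒞.R, 𝒞.B, σ), 𝒞 the classical datum (OPEN; a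
conjecture item, never a
Literature fact; not named verbatim here);
CellwiseVGoodTransfer typed over the (enriched) `ClassicalPeriodDatum`; ResolvedSection := ∃ Ψ :
𝒞.NoriSymbolData σ with
Φ ∘ Ψ.symbol = (· ⊗ 1) on the resolved sector; glue = the four-line chain of § Thesis (the tree
already proves the faithfulness variant,
`KZ.kernel_subset_relations_of_isFaithful`). BLOCKED TODAY by the interface, not by imports (NOT
DECOMPOSED YET (i)). Typing constraints (crux attack on record 6300 + gen-4): the
three children share ONE datum 𝒞 (∀𝒞 over the enriched interface, or FPC + generation + section
bundled as one ∃𝒞 conjecture item); Φ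
additive into P_KZ × P_KZ suffices (no ⊗ ℚ̄; m = 1, T unused on this branch) and 'kills the SPAN of
the relators'; rational chain
coefficients are folded into the cell integrands; one-line candidates that elaborate (lean rc 0) and
are cone-clean are on file (Probe.lean
on record 6300; gen-4 folder Sketch.lean / cand_oneline.txt) and lack exactly the kernel hypothesis.
Until then provers work N, T, the supports and LegendreCompiled, all typed over KZCalculus. Below
the rank-2 crux: CellwiseVGoodTransfer ⇐ SmoothVertices (global top forms, strict C^p
triangulation, the two Stokes supports + Stokes WITH face terms) → SingularVertices (resolution +
affine Čech presentation; independence of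
resolution / cover / cocycle / chain) → TripleBoundary (edge (B) across three presentations) (k =
3). LegendreCompiled ⇐
MotivicLegendreAsEdges (the cup-product identity as explicit Pairs^eff relators on E, E×E, ℙ¹) →
CompileEdges.

KILL CRITERIA. ResolvedRepsKernel refuted (an explicit ℤ-combination of bounded C¹ representations
with value 0 and no multiple in
KZ.relations) refutes the summit itself in kernel form on the sector — close
`refuted:ResolvedRepsKernel`, hand the witness to route Neg,
and every positive route of the summit dies with it. RationalRepsResolve refuted (some
rational-shape representation admits no in-rules
resolution into the sector) kills the frame N: pivot N and X together to a sector the moves do reach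
(e.g. letting the dimension grow:
volumes of compact (d+1)-dimensional ℚ̄∩ℝ-semialgebraic sets, ViuSos2021 Thm. 1.1 / Cor. 2.3, p. 7
read) with the same glue, or close if
no move-stable resolved sector exists.
TorsionFree refuted kills T here and in CoactionDevissage, not the line: re-type X in ℤ-form (m =
1), which FPC + Φ + Ψ deliver directly
with Φ into P_KZ × P_KZ (additive maps from a ℚ̄-space into the divisible group P_KZ are
unobstructed; `no_additive_transfer_section`
concerns maps into the free group FormalRep). Refutation
of LegendreCompiled by an additive invariant of FormalRep vanishing on the four move sets (shape of
route Neg item 0313): since the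
Legendre identity IS a formal relation for the classical datum (cup product is a morphism of
effective Nori motives), this refutes every
faithful/transferable Ψ, hence the mechanism — close `refuted:LegendreCompiled` and hand the
invariant to route Neg. Refutation of either Stokes
support (rule (3) weaker than Stokes on simplices) is fatal for every structural route of the
summit: close and escalate to the operator. FPC refuted ⇒ all positive routes die;
the kernel form of Conjecture 1 (the tree's @[conjecture] constant of PeriodConjecture.lean) proved
elsewhere moots this route.

NOT DECOMPOSED YET. (i) The motivic layer — FPCClassical, the typed CellwiseVGoodTransfer,
ResolvedSection and their glue into X — is
DELIBERATELY outside the route file. Gen-2 kept it out for the module import cone of Sweep1 (→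
RelativePeriods → PeriodComparison →
Comparison → Correspondences, which declares the OPEN standard conjectures); gen-4 MEASURED that
this no longer matters: staffability is
computed on the constant cone (`#h21_route_deps`), and the candidate typed transfer with `import
Literature.AlgebraicGeometry.Motives.ClassicalPeriodDatum` reaches 227 project constants whose only
closed Prop facts are the summit,
its own conjecture constant (via the statement) and the route's own items — 0 unproved, no sorry,
standard axioms
(gate-native preview; defn-ConjectureFreePeriodDatumPrelude is MOOT here, evidence attached to it).
What blocks the typing is the
INTERFACE. (a) `ClassicalPeriodDatum.formClass` is posited (additive, k-linear, natural, with
connecting morphisms and period formula)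
WITHOUT ITS KERNEL; `isPerfPair_pairingBaseChange` + the period formula pin the kernel only to 'all
periods over relative Betti classes
vanish', and the step to 'relatively exact as a presented form' is the algebraic de Rham /
comparison theorem of the smooth affine pair —
true classically, absent in a junk model, invisible to the moves. So a ∀𝒞 typing whose normalisation
quantifies over all presentations
of one symbol CLASS (it must: Ψ produces presentations) is summit-implied (under Conjecture 1
compose ev with an additive retraction
ℂ ⊇ 𝒫 → P_KZ × P_KZ) but provable by the mechanism only given the kernel — tier-0 cone debt if a
Literature named fact (Grothendieck
comparison), vocabulary if a FIELD of the hypothesis structure (two-speed convention). (b) For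
SINGULAR very good vertices the datum
presents nothing: the Čech/resolution presentation needs excision for resolutions that are
isomorphisms off D and a Čech–de Rham
presentation of H^d(X̃, D̃) by regular forms on an affine cover WITH its period formula, as fields;
the alternative hypothesis 'smooth
affine presented symbols generate 𝒫̃⁺ and their relators the relations' is
HuberMullerStachPeriods2017 Rem. 13.1.8's open question and
would change the bet of the line (recorded, not adopted). (c) Very-good generation (Cor. 13.1.7(1))
is wanted as a field, or typed over `IsFormalPeriodRelator` with a
predicate on `Finsupp.support` ('relator all of whose symbols are very good'; no second inductive).
Re-entry: definition request (4)
lands ⇒ `route edit --split ResolvedRepsKernel --into FPCClassical CellwiseVGoodTransferTyped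
ResolvedSection` (shared 𝒞; glue = the
four-line chain of § Thesis). (ii) The internals of CellwiseVGoodTransfer (chain-level descent along
resolution + Čech data;
independence of all choices; the (B) edge of a very good triple through three unrelated
presentations); the real-structure bookkeeping
(complex symbol ↦ pair of real representations, ℚ̄ = k_ℝ ⊕ i·k_ℝ via
AlgebraicScalingActsOnRelations); ℚ-definability of triangulations
and resolutions (real-closed-field transfer: auxiliary data over ℝ_alg); Nori's diagram category as
Literature definitions (theorems in
print — definition requests, not cruxes); Stokes on a simplex WITH face terms (the (B)-engine;
KZ-level, typable over KZCalculus, to be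
filed as a support next to StokesSimplexVanishingBoundary when a prover reaches (B)); the converse
direction KZ.relations ↦ formal
relations (Ψ2 of `KZ.NoriSymbolData`; never needed for `closes`).

CHEAPEST FALSIFIER. (i) Lean, an afternoon: prove NewtonLeibnizAnyCoordinate for n = 1, j = 0 and
StokesSimplexVanishingBoundary for d + 1 = 1
— if `KZ.newtonLeibnizRel` plus a coordinate swap cannot express Newton–Leibniz along the first of
two coordinates, the presentation
layer is misdesigned. (ii) Lean, an afternoon: TorsionFree for n = 2 on one generator [r] (the slab
argument) — if the
translation t ↦ t − 1/2 or the slab cut is not a move instance as typed, T and the ℚ-coefficient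
frame fail here and in CoactionDevissage.
(iii) Paper, an hour: write the Čech presentation of the symbol (E, ∅, [x dx/y], γ) for the complete
lemniscatic curve E (second-kind
form, pole at ∞, no global representative): two affine charts, one 0-cochain correction; check that
every resulting integral converges
absolutely and every identification is a rule instance — step one of LegendreCompiled, the smallest
case where "no global form" bites. (iv) Lookup: Pawlucki2023 — strict C^p triangulations compatible
with finitely many semialgebraic
subsets and definable over ℝ_alg? If only strict C¹ (CzaplaPawlucki2018) has compatibility, fall
back to CAD + the fibrewise
total-variation lemma (semialgebraic continuous ⇒ ∂_jη_j ∈ L¹) as a layer-2 child.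

NUMBERS. Legendre at k² = 1/2: 2EK − K² = π/2 (item 0280 docstring: checked numerically to 1e−13);
trdeg_ℚ ℚ(K, E, π) = 2 (Chudnovsky1976), so
0280 is the only algebraic relation in its sector. Items after the gen-4 repair: 8 — target
ResolvedRepsKernel (7967), cruxes LegendreCompiled (0280, rank 3),
RationalRepsResolve (5089, rank 4), supports TorsionFree (3169), NewtonLeibnizAnyCoordinate (5090),
StokesSimplexVanishingBoundary (5091),
AlgebraicScalingActsOnRelations (5092), Assembly (11055); re-sited to the two-layer plan:
CellwiseVGoodTransfer (6300, informal, closed moot); dropped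
earlier: KZTransferPackage (5088), gen-1 Assembly (5093). Header prose (gen-6): off-roster records
and OPEN
conjecture constants are named in words only (no `stmt-` ids, no verbatim decl names). Extra
imports: none; cone 27 project constants, 0 unproved (gate 16:38Z); with the
candidate typed transfer + import ClassicalPeriodDatum: 227 constants, 0 unproved (gate-native
preview, gen-4). Deciding
theorem: closes (h₁ : RationalRepsResolve) (h₂ : ResolvedRepsKernel) (h₃ : TorsionFree) :
KontsevichZagierPeriods, 30 lines, axioms
propext / Classical.choice / Quot.sound. HMS draft pages read by the opener: 1–3, 8–11, 29–33
(paper:galaxy-pdf-1872635349266679900).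

DEFINITION REQUESTS. (1) ClassicalPeriodDatum — LANDED 2026-08-15
(Literature/AlgebraicGeometry/Motives/ClassicalPeriodDatum.lean, a
hypothesis structure; WARNING §1: ∃ over it is witnessed by any model, ∀ is exposed to junk),
together with `KZ.SymbolMap` /
`KZ.NoriSymbolData` / `KZ.noriSymbol` (Literature/NumberTheory/Transcendental/KZNoriSymbol.lean) —
importable directly (gen-4:
the module import path is not a staffability issue under the constant-level rule). (2)
ConjectureFreePeriodDatumPrelude (defn item, gen-2, for a conjecture-free MODULE import
path) — MOOT under the constant-level rule (gen-4 evidence on the item); its holder / the operator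
may close it. (3) Still wanted: VeryGoodPair + the diagram
VGood^eff + the named fact HMS Cor. 13.1.7(1) (P(VGood^eff) → 𝒫̃⁺ is an isomorphism) over
`IsFormalPeriodRelator` (any import path; see (4)(iii)). Cite facts wanted: strict C^p triangulation
compatible with finitely many semialgebraic subsets
(CzaplaPawlucki2018 Thm. 1; Pawlucki2023); Hardt triviality; embedded resolution over ℚ
(Hironaka1964); semialgebraic chains compute the
homology of (X(ℂ), D(ℂ)) (BochnakCosteRoy1998 §11.7).
(4) NEW (gen-4): ClassicalPeriodDatumKernel (topic Literature/AlgebraicGeometry/Motives; defn item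
filed for the target, ledger record 7967, full text
there) — enrich the interface, as FIELDS, with (i) the de Rham kernel on smooth affine pairs (a
presented top form has formClass 0 iff it
is relatively exact in presented form, iff all its periods over ℝ-semialgebraic relative d-cycles
vanish: HuberMullerStachPeriodsI2015
Def. 3.2.6 / Prop. 3.2.9, HuberJorder2014 Prop. 4.2, Grothendieck's algebraic de Rham theorem,
Huber2023 Thm. 7.5); (ii) excision off D +
Čech–de Rham presentation with period formula for singular very good pairs
(HuberMullerStachPeriodsI2015 Prop. 3.2.11); (iii) very-good
generation (HuberMullerStachPeriods2017 Cor. 13.1.7(1)) with `VeryGoodPair`. With (i) alone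
SmoothVertices is typable so that junk models
no longer obstruct a proof by the moves while it stays summit-implied; with (i)–(iii) the whole
CellwiseVGoodTransfer is.

Novelty: Searches (2026-08-15): the card's audit (refuter-novelty-8: `lit search --hybrid`, zbMATH
'Kontsevich Zagier period conjecture' (9) and
'Nori motives Kontsevich periods' (3), `lit galaxy search "very good pairs" --star all` → only the
HMS draft); the opener's: `lit vsearch
"three rules … generate all relations of the formal period algebra … very good pairs … without
inverting 2πi"` (10 docs; nearest
HuberWustholz2022 pp. 10–11), `lit frontier KontsevichZagierPeriods --since 2021` (30 rows; only
arXiv:2401.13547 and doi:10.5802/jep.335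
touch Nori motives / regularised integrals), `lit search --source crossref "Czapla Pawlucki strict
triangulations"` (8 rows:
doi:10.12775/tmna.2018.033, doi:10.1007/s13163-023-00471-4, doi:10.2140/gt.2012.16.2067),
HuberMullerStachPeriodsIII2015 pp. 1–3, 8–11,
29–33 READ; at repair: `lit read arxiv:1509.01097 --grep rules|volume` (ViuSos2021 Thm. 1.1, Cor.
2.1–2.3, pp. 2, 5, 7 read: the
reduction to compact domains with pole-free rational integrands "respecting the KZ-rules" — nearest
prior art of RationalRepsResolve) and
`lit read doi:10.5802/jtnb.1204 --grep Theorem|Conjecture|volume` (CressonViusos2022 Conj. 1.1 GKZ,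
Thm. 2.1 GKZ ⇒ KZ, Thm. 3.2, pp. 5,
10, 14 read: nearest prior art of the restated frame N + sector conjecture ⇒ KZ).
Nearest prior art found: HuberMullerStachPeriodsIII2015 Cor. 12.1.6(1) + Rem. 12.1.7 (=
HuberMullerStachPeriods2017 Cor. 13.1.7(1) + Rem.
13.1.8) and Rem. 9.4.4; ViuSos2021 Thm. 1.1 / Cor. 2.2 (arXiv:1509.01097) a  [refs: 10.5802/jep.335, 10.12775/tmna.2018.033, 10.1007/s13163-023-00471-4, 10.2140/gt.2012.16.2067, 10.5802/jtnb.1204, 2401.13547, 1509.01097, doi:10.5802/jep.335, doi:10.12775/tmna.2018.033, doi:10.1007/s13163-023-00471-4, doi:10.2140/gt.2012.16.2067, arxiv:1509.01097, doi:10.5802/jtnb.1204, HuberWustholz2022, HuberMullerStachPeriodsIII2015, ViuSos2021, CressonViusos2022, HuberMullerStachPeriods2017, A]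

Barriers (technique_class: diagram-transfer, semialgebraic-stokes, nori-basic-lemma): - technique_class: diagram-transfer, semialgebraic-stokes, nori-basic-lemma
- Literature.Barriers.KontsevichZagierPeriods.noSemialgebraicPrimitive_inv_sub_two: evaded — no
primitive is ever sought: in every Newton–Leibniz instance of the presentation layer the primitive
is a GIVEN coefficient of a pulled-back polynomial form (semialgebraic by construction), and
dimension drops only through ∂ on chains, never by integrating a variable out; RationalRepsResolve
likewise never integrates out (ViuSos2021 is listed among the barrier's own evasions_known).
- Literature.Barriers.KontsevichZagierPeriods.kzConjecture_implies_oddZetaAlgIndep: conceded and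
quarantined — the route proves nothing numerical; all transcendence strength sits in the formal
period conjecture behind the target ResolvedRepsKernel, named as load-bearing.
- Literature.Barriers.KontsevichZagierPeriods.kzConjecture_implies_twoPiI_log_algIndep: same —
quarantined in the target.
- Literature.Barriers.KontsevichZagierPeriods.kzConjecture_implies_ellipticPeriods_algIndep: same —
quarantined in the target; LegendreCompiled asserts one RELATION, not independence.
- Literature.Barriers.KontsevichZagierPeriods.cressonViuSos_prop_3_2: not engaged — the presentation
and the resolution use scissors (domain additivity) everywhere; no global semialgebraic map between
two representations is ever claimed.
- Literature.Barriers.KontsevichZagierPeriods.not_complete_of_undecidable: consistent — the line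
makes KZ-derivability of motivi

Novelty grade: new-combination — ROUTE REVIEW (refuter 2026-08-15). Novelty: HMS Cor 13.1.7(1) (very-good presentation of 𝒫̃⁺) + KZ top-degree calculus, transfer typed free-abelian→ℚ̄ to evade NoriTransferRefutations.no_additive_transfer_section ✓ (so NOT a recombination of the closed NoriTransfer): new-combination; the mechanism ( (refuter refuter-rreview-route-ValiantsHypothesis-347721ba-0, 2026-08-15T13:46:12Z; prior: HuberMullerStachPeriods2017 (Cor 13.1.7(1) very good pairs; Rem 13.1.8; Conj 13.2.1), HuberMullerStachPeriodsIII2015 (Cor 12.1.6, Rem 12.1.7, Rem 9.4.4), Kontsevich1999 §4 (formal periods, Def 20), Ayoub2015 / AyoubRelKZRevisited Rem 1.3 (cube presentation over D((2πi)^-1)), route NoriTransfer + Theorems/NoriTransferRefutations (refuted typing 0190), Literature/AlgebraicGeometry/Motives/ClassicalP)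

History (route lifecycle, newest last):
- 2026-08-15T16:38:14Z · rev 2: restated Assembly (stmt-KontsevichZagierPeriods-5093) — route-repair gen 2 (parts 2+3 combined): RE-ROUTE AROUND the standard-conjecture cone — drop the gen-1 target KZTransferPackage (5088, the only decl over Sweep1 (planner-rbadge-KontsevichZagierPeriods-VeryGoo-164590cd-g2-0)
- 2026-08-15T16:38:14Z · rev 2: dropped KZTransferPackage — route-repair gen 2 (parts 2+3 combined): RE-ROUTE AROUND the standard-conjecture cone — drop the gen-1 target KZTransferPackage (5088, the only decl over Sweep1 (planner-rbadge-KontsevichZagierPeriods-VeryGoo-164590cd-g2-0)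
- 2026-08-15T17:22:33Z · rev 4: dropped CellwiseVGoodTransfer — route-repair gen 4 (badge; needs_repair 'crux-hygiene: stmt-6300' stamped 14:53Z and not cleared by the gen-2/gen-3 retriages that DID put why/sources on its ba (planner-rbadge-KontsevichZagierPeriods-VeryGoo-164590cd-g4-0)
- 2026-08-16T04:09:52Z · AUTO-CRUX (backfill): ResolvedRepsKernel — hypotheses of the deciding theorem that nothing in the route derives are cruxes (operator:999:1085951)
- 2026-08-23T17:01:07Z · DORMANT — reconciler: no traction for 6.1 d (last activity item-proof-filed at 2026-08-17T13:07:45Z); parked, not closed — `ledger route dormant route-KontsevichZagierPer (operator:999:3454274)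

sub-problem: KontsevichZagierPeriods · status: dormant · opened planner-plancard-KontsevichZagierPeriods-Kont-1c96ad34-0 2026-08-15T11:39:50Z · rev 5 · ledger route-KontsevichZagierPeriods-VeryGoodTransfer
GENERATED by the gate from the ledger (D-0016/17). Provers cite these decls: `theorem foo : Summit.KontsevichZagierPeriods.KontsevichZagierPeriods.Theses.VeryGoodTransfer.<Decl> := …` in Summits/KontsevichZagierPeriods/KontsevichZagierPeriods/Theorems/<Name>.lean.
-/

namespace Summit.KontsevichZagierPeriods.KontsevichZagierPeriods.Theses.VeryGoodTransfer

open scoped BigOperators Topology Manifold Classical MeasureTheory ProbabilityTheory Matrix InnerProductSpace ComplexConjugate ContinuousMap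
open Filter Set Function TopologicalSpace MeasureTheory

attribute [summit_statement] _root_.KontsevichZagierPeriods

open Literature Periods

/-- item stmt-KontsevichZagierPeriods-0280 · crux · rank 3 · closed · proved by Summit.KontsevichZagierPeriods.Grothendieck.GpcLegendreLemniscaticLine.GpcLegendreLemniscatic_proof @ 3de250ba37b9 (prover) · by planner
why it might fail: Every printed proof deforms the modulus or uniformises; compiling the cup product needs Stokes on semialgebraic 2- and 3-chains in E×E(ℂ) ⊂ ℝ⁸ with second-kind forms whose poles at ∞ must stay off every intermediate (absolutely convergent) chain.
sources: Chudnovsky1976, HuberWustholz2022, KontsevichZagier2001, HuberMullerStachPeriods2017, Andre2004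
K = ∫₀¹ dx/√((1−x²)(1−x²/2)), E = ∫₀¹ √(1−x²/2)/√(1−x²) dx (complete elliptic integrals, modulus k²
= 1/2, lemniscatic/CM curve, K′ = K, E′ = E); Legendre: EK′ + E′K − KK′ = π/2 becomes 2EK − K² = π/2
(checked numerically to 1e−13). LHS filed as ONE 2-dim semialgebraic rep on (0,1)² with integrand
2e(x)k(y) − k(x)k(y); RHS as ∫_ℝ dx/(2(1+x²)). Motivic origin: the cup-product/Poincaré-duality
pairing H¹_dR × H¹_dR → H²_dR(E) ≅ ℚ̄(−1) of the elliptic curve y² = (1−x²)(1−x²/2) — a 'boundary +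
functoriality' relation in the formal period algebra, hence predicted to lie in KZ.relations by
route NoriTransfer #2. Known proofs differentiate in k (a RELATIVE-period argument à la Ayoub) or
integrate over the period parallelogram (transcendental uniformisation); an H21 proof must run
Stokes on a semialgebraic 2-chain in E(ℂ) ⊂ ℝ⁴ cut along real-algebraic paths, reduced to
Newton–Leibniz bands. Chudnovsky1976 (tree fact) shows trdeg ℚ(K, E, π) = 2, so this is the ONLY
algebraic relation among K, E, π up to the ideal it generates — a complete sector once accessible.
[elaborates: yes: _survey/SketchC.lean; sources: Chudnovsky1976, KontsevichZagier2001,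
HuberMullerStach2017, Andre2004] -/
@[route_item "route-KontsevichZagierPeriods-VeryGoodTransfer"]
def LegendreCompiled : Prop :=
  ∀ (r : Literature.NumberTheory.Transcendental.KZ.IntegralRep 2) (r' : Literature.NumberTheory.Transcendental.KZ.IntegralRep 1), r.domain = {x | ∀ i, x i ∈ Set.Ioo (0:ℝ) 1} → Set.EqOn r.integrand (fun x => 2 * Real.sqrt (1 - x 0 ^ 2 / 2) / Real.sqrt (1 - x 0 ^ 2) / Real.sqrt ((1 - x 1 ^ 2) * (1 - x 1 ^ 2 / 2)) - 1 / Real.sqrt ((1 - x 0 ^ 2) * (1 - x 0 ^ 2 / 2)) / Real.sqrt ((1 - x 1 ^ 2) * (1 - x 1 ^ 2 / 2))) r.domain → r'.domain = Set.univ → Set.EqOn r'.integrand (fun x => 1 / (2 * (1 + x 0 ^ 2))) r'.domain → Literature.NumberTheory.Transcendental.KZ.Equivalent r r'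

/-- `LegendreCompiled` holds: proved by `Summit.KontsevichZagierPeriods.Grothendieck.GpcLegendreLemniscaticLine.GpcLegendreLemniscatic_proof` @ 3de250ba37b9. -/
theorem LegendreCompiled_holds : LegendreCompiled := _root_.Summit.KontsevichZagierPeriods.Grothendieck.GpcLegendreLemniscaticLine.GpcLegendreLemniscatic_proof

/-- item stmt-KontsevichZagierPeriods-5089 · crux · rank 4 · open · by planner
why it might fail: ViuSos2021 Thm 1.1 reaches compact domains only by RAISING the dimension (volume form); as typed the resolution keeps dimension n with integrand C¹ on a nbhd of the closure, so each blow-up / x ↦ 1/x / ramification chart must be ONE injective ℚ-semialgebraic changeOfVariablesRel instance, in place.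
sources: ViuSos2021, arXiv:1509.01097, HuberMullerStachPeriodsIII2015, BelkaleBrosnan2003, Hironaka1964, BochnakCosteRoy1998
[crux] resolution of singularities inside the rules (the H21 half of the Section Ψ; card item N):
every representation of KZ's rational shape is move-equivalent to a ℤ-combination of representations
of the same dimension with BOUNDED domain and integrand C¹ on an open neighbourhood of the closure
of the domain (no boundary singularity, no unbounded direction) — by cylindrical decomposition,
blow-up charts of a ℚ-resolution used as change-of-variables moves on open cells, and the HMS
monomial argument "absolute convergence ⇒ exponents ≥ 0" (draft Lemma 11.2.2, p. 29 read).
[difficulty: L] -/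
@[route_item "route-KontsevichZagierPeriods-VeryGoodTransfer", crux]
def RationalRepsResolve : Prop :=
  ∀ (n : ℕ) (r : Literature.NumberTheory.Transcendental.KZ.IntegralRep n), r.IsRational → ∃ (k : ℕ) (ρ : Fin k → Literature.NumberTheory.Transcendental.KZ.IntegralRep n) (ε : Fin k → ℤ), (∀ i, Bornology.IsBounded (ρ i).domain ∧ ∃ U : Set (Fin n → ℝ), IsOpen U ∧ closure (ρ i).domain ⊆ U ∧ ContDiffOn ℝ 1 (ρ i).integrand U) ∧ Literature.NumberTheory.Transcendental.KZ.of r - ∑ i, ε i • Literature.NumberTheory.Transcendental.KZ.of (ρ i) ∈ Literature.NumberTheory.Transcendental.KZ.relations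

/-- item stmt-KontsevichZagierPeriods-7967 · crux (kind.auto-crux: conjecture-grade) · rank 5 · open · by planner
why it might fail: Period-conjecture strength on the resolved sector (≡ summit given N + T): false as soon as one motivic relation among bounded C¹ integrals — e.g. a (B)-edge through a singular very good vertex, HMS Rem. 13.1.8 — is no finite chain of absolutely convergent moves.
sources: KontsevichZagier2001, Kontsevich1999, HuberMullerStachPeriodsIII2015, HuberMullerStachPeriods2017, ViuSos2021, CressonViusos2022
[crux] ResolvedRepsKernel — route-repair 2026-08-15: the KZ-level replacement for the target
KZTransferPackage (stmt-5088), filed as a crux (rank 5) until the route's planner/operator applies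
the prepared owner edit (drop 5088; restate Assembly := RationalRepsResolve → ResolvedRepsKernel →
TorsionFree → KontsevichZagierPeriods, proved sorry-free in the repair planner's Sketch.lean;
imports := []; then re-kind this item to target rank 0). STATEMENT: the period conjecture with
ℚ-coefficients on the RESOLVED sector — every ℤ-combination c of integral representations with
bounded domain and integrand C¹ on an open neighbourhood of the closure of the domain (any
dimensions) with KZ.eval c = 0 has some m ≠ 0 with m • c ∈ KZ.relations. Equivalent to the summit
given RationalRepsResolve + TorsionFree; it is exactly what Kontsevich's formal period conjecture
for the classical datum plus the cellwise very-good transfer (rank-2 crux CellwiseVGoodTransfer,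
stmt-6300) deliver (eval c = 0 ⇒ ev(sym c) = 0 ⇒ sym c ∈ formal relations ⇒ c ⊗ 1 = 0 in P_KZ ⊗ ℚ̄),
stated over the KZ calculus alone so that the route needs no Motives import (the 12 unproved
standard-conjecture facts of Motives/Correspond -/
@[route_item "route-KontsevichZagierPeriods-VeryGoodTransfer", crux]
def ResolvedRepsKernel : Prop :=
  ∀ c ∈ AddSubgroup.closure {x : Literature.NumberTheory.Transcendental.KZ.FormalRep | ∃ (n : ℕ) (ρ : Literature.NumberTheory.Transcendental.KZ.IntegralRep n), Bornology.IsBounded ρ.domain ∧ (∃ U : Set (Fin n → ℝ), IsOpen U ∧ closure ρ.domain ⊆ U ∧ ContDiffOn ℝ 1 ρ.integrand U) ∧ x = Literature.NumberTheory.Transcendental.KZ.of ρ}, Literature.NumberTheory.Transcendental.KZ.eval c = 0 → ∃ m : ℕ, m ≠ 0 ∧ m • c ∈ Literature.NumberTheory.Transcendental.KZ.relations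

/-- item stmt-KontsevichZagierPeriods-3169 · support · rank 9 · closed · proved by Summit.KontsevichZagierPeriods.CoactionDevissage.TorsionFree.exceptionalCouplings_torsionFree_proof @ f648441f8c8f (prover) · by planner
sources: KontsevichZagier2001, Literature.NumberTheory.Transcendental.KZ.mul_mem_relations_right_holds, Literature.NumberTheory.Transcendental.KZ.of_mul_of
[support] P_KZ is torsion-free: n ≠ 0, n • c ∈ KZ.relations ⇒ c ∈ KZ.relations. Proof: c − c·[0,1] ∈
relations (Newton–Leibniz on each generator r with base r, band r.domain × [0,1] = (r.prod
I₀₁).domain, F(x,t) = t·f(x)); c·[0,1] − n • (c·[0,1/n]) ∈ relations (domain additivity into n slabs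
over the null overlaps r.domain × {k/n}, translations t ↦ t − k/n as changes of variables); n •
(c·[0,1/n]) = (n • c)·[0,1/n] ∈ relations by `KZ.mul_mem_relations_right_holds`. Card item D0.
[difficulty: provable-now] -/
@[route_item "route-KontsevichZagierPeriods-VeryGoodTransfer", crux]
def TorsionFree : Prop :=
  ∀ (n : ℕ) (c : Literature.NumberTheory.Transcendental.KZ.FormalRep), n ≠ 0 → n • c ∈ Literature.NumberTheory.Transcendental.KZ.relations → c ∈ Literature.NumberTheory.Transcendental.KZ.relations

/-- item stmt-KontsevichZagierPeriods-5090 · support · rank 9 · closed · proved by Summit.KontsevichZagierPeriods.VeryGoodTransfer.newtonLeibnizAnyCoordinate_proof @ 521edfcc003a (prover) · by planner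
sources: KontsevichZagier2001, HuberMullerStachPeriods2017
[support] rule (3) along an ARBITRARY coordinate j of ℝⁿ⁺¹ (band in direction j over a base in the
remaining coordinates, same fibrewise regularity as `KZ.newtonLeibnizRel`) is a relation — by the
coordinate-permutation change of variables (|det| = 1) followed by the fixed last-coordinate move.
[difficulty: provable-now] -/
@[route_item "route-KontsevichZagierPeriods-VeryGoodTransfer"]
def NewtonLeibnizAnyCoordinate : Prop :=
  ∀ (n : ℕ) (j : Fin (n + 1)) (r : Literature.NumberTheory.Transcendental.KZ.IntegralRep (n + 1)) (r' : Literature.NumberTheory.Transcendental.KZ.IntegralRep n) (a b : (Fin n → ℝ) → ℝ) (F : (Fin (n + 1) → ℝ) → ℝ), Literature.NumberTheory.Transcendental.IsSemialgebraicFunOn ℚ r.domain F → Literature.NumberTheory.Transcendental.IsSemialgebraicFunOn ℚ r'.domain a → Literature.NumberTheory.Transcendental.IsSemialgebraicFunOn ℚ r'.domain b → (∀ x ∈ r'.domain, a x ≤ b x) → r.domain = {z | (Fin.removeNth j z : Fin n → ℝ) ∈ r'.domain ∧ a (Fin.removeNth j z : Fin n → ℝ) ≤ z j ∧ z j ≤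 b (Fin.removeNth j z : Fin n → ℝ)} → (∀ x ∈ r'.domain, ContinuousOn (fun t : ℝ => F (Fin.insertNth j t x : Fin (n + 1) → ℝ)) (Set.Icc (a x) (b x))) → (∀ x ∈ r'.domain, ∀ t ∈ Set.Ioo (a x) (b x), HasDerivAt (fun s : ℝ => F (Fin.insertNth j s x : Fin (n + 1) → ℝ)) (r.integrand (Fin.insertNth j t x : Fin (n + 1) → ℝ)) t) → (∀ x ∈ r'.domain, r'.integrand x = F (Fin.insertNth j (b x) x : Fin (n + 1) → ℝ) - F (Fin.insertNth j (a x) x : Fin (n + 1) → ℝ)) → Literature.NumberTheory.Transcendental.KZ.of r - Literature.NumberTheory.Transcendental.KZ.of r' ∈ Literature.NumberTheory.Transcendental.KZ.relations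

/-- item stmt-KontsevichZagierPeriods-5091 · support · rank 9 · open · by planner
sources: KontsevichZagier2001, CzaplaPawlucki2018, Pawlucki2023
[support] Lemma S on the open standard simplex Δ ⊂ ℝ^{d+1} with boundary values zero: if η₀,…,η_d
are ℚ-semialgebraic and continuous on the closed simplex, vanish on its boundary, and ∂_jη_j exists
at every point of Δ and is the integrand of a representation ρ_j on Δ, then the representation of
Σ_j ∂_jη_j on Δ is a relation (value 0) — d+1 Newton–Leibniz moves (Δ is a band in each direction) +
additivity; the engine of presentation-independence. [difficulty: M] -/
@[route_item "route-KontsevichZagierPeriods-VeryGoodTransfer"]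
def StokesSimplexVanishingBoundary : Prop :=
  ∀ (d : ℕ) (η : Fin (d + 1) → (Fin (d + 1) → ℝ) → ℝ) (ρ : Fin (d + 1) → Literature.NumberTheory.Transcendental.KZ.IntegralRep (d + 1)) (r : Literature.NumberTheory.Transcendental.KZ.IntegralRep (d + 1)), (∀ j, Literature.NumberTheory.Transcendental.IsSemialgebraicFunOn ℚ (closure {x : Fin (d + 1) → ℝ | (∀ i, 0 < x i) ∧ ∑ i, x i < 1}) (η j)) → (∀ j, ContinuousOn (η j) (closure {x : Fin (d + 1) → ℝ | (∀ i, 0 < x i) ∧ ∑ i, x i < 1})) → (∀ j, ∀ x ∈ frontier {x : Fin (d + 1) → ℝ | (∀ i, 0 < x i) ∧ ∑ i, x i < 1}, η j x = 0) → (∀ j, (ρ j).domain = {x : Fin (d + 1) → ℝ | (∀ i, 0 < x i) ∧ ∑ i, x i < 1}) → (∀ j, ∀ x ∈ (ρ j).domain, HasDerivAt (fun t : ℝ => η j (Function.update x j t)) ((ρ j).integrand x) (x j)) → r.domain = {x : Fin (d + 1) → ℝ | (∀ i, 0 < x i) ∧ ∑ i, x i < 1} → Set.EqOn r.integrand (fun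 x => ∑ j, (ρ j).integrand x) r.domain → Literature.NumberTheory.Transcendental.KZ.of r ∈ Literature.NumberTheory.Transcendental.KZ.relations

/-- item stmt-KontsevichZagierPeriods-5092 · support · rank 9 · closed · proved by Summit.KontsevichZagierPeriods.VeryGoodTransfer.algebraicScalingActsOnRelations_proof @ ab8a8d9d2cbf (prover) · by planner
sources: KontsevichZagier2001, HuberMullerStachPeriods2017
[support] the k_ℝ-module structure of P_KZ used to type Φ (card: "target the k_ℝ-module P_KZ"): for
every real algebraic a there is an additive endomorphism s_a of FormalRep, sending each [σ, f] to (a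
representation of) [σ, a·f], which maps KZ.relations into itself — each scaled move instance is
again a move instance. [difficulty: provable-now] -/
@[route_item "route-KontsevichZagierPeriods-VeryGoodTransfer"]
def AlgebraicScalingActsOnRelations : Prop :=
  ∀ a : ℝ, IsAlgebraic ℚ a → ∃ s : Literature.NumberTheory.Transcendental.KZ.FormalRep →+ Literature.NumberTheory.Transcendental.KZ.FormalRep, (∀ c ∈ Literature.NumberTheory.Transcendental.KZ.relations, s c ∈ Literature.NumberTheory.Transcendental.KZ.relations) ∧ ∀ (n : ℕ) (r r' : Literature.NumberTheory.Transcendental.KZ.IntegralRep n), r'.domain = r.domain → Set.EqOn r'.integrand (fun x => a * r.integrand x) r.domain → s (Literature.NumberTheory.Transcendental.KZ.of r) - Literature.NumberTheory.Transcendental.KZ.of r' ∈ Literature.NumberTheory.Transcendental.KZ.relations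

-- earlier Assembly (stmt-KontsevichZagierPeriods-5093, replaced 2026-08-15T16:38:14Z -> stmt-KontsevichZagierPeriods-11055): retired by None — KZTransferPackage → KontsevichZagierPeriods
/-- item stmt-KontsevichZagierPeriods-11055 · assembly · rank 1 · closed · proved by Summit.KontsevichZagierPeriods.VeryGoodTransfer.assembly_proof @ 9b51b4ab5762 (prover) · by planner
sources: KontsevichZagier2001, HuberMullerStachPeriods2017
[assembly] N → X → T → summit: RationalRepsResolve → ResolvedRepsKernel → TorsionFree →
KontsevichZagierPeriods — the same implication as the certified deciding theorem `closes`
(glue.lean, gen-2 route-repair 2026-08-15; 30 lines: resolutions [r] − S, [r′] − S′ ∈ relations, S −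
S′ in the resolved sector with eval 0 by `KZ.relations_le_ker_eval_holds`, X gives m • (S − S′) ∈
relations, T removes m). Provable now: `fun h₁ h₂ h₃ => closes h₁ h₂ h₃`. Replaces the gen-1
Assembly `KZTransferPackage → KontsevichZagierPeriods` (5093) whose hypothesis is dropped with the
Sweep1 import. [difficulty: provable-now] -/
@[route_item "route-KontsevichZagierPeriods-VeryGoodTransfer"]
def Assembly : Prop :=
  RationalRepsResolve → ResolvedRepsKernel → TorsionFree → KontsevichZagierPeriods

/-! D-0027 §2.1 — DECIDING THEOREM (planner-authored via `route open/edit --closes-file`; by planner-rbadge-KontsevichZagierPeriods-VeryGoo-164590cd-g2-0 2026-08-15T16:38:14Z):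
its hypotheses are this route's items and its conclusion the sub-problem Statement (glue_lint), and it elaborates with this file. -/

@[closes "route-KontsevichZagierPeriods-VeryGoodTransfer"] theorem closes (h₁ : RationalRepsResolve) (h₂ : ResolvedRepsKernel) (h₃ : TorsionFree) : KontsevichZagierPeriods := by
  intro n m r r' hr hr' hv
  obtain ⟨k, ρ, ε, hρ, hrel⟩ := h₁ n r hr
  obtain ⟨k', ρ', ε', hρ', hrel'⟩ := h₁ m r' hr'
  -- the two resolved combinations
  set S : Literature.NumberTheory.Transcendental.KZ.FormalRep :=
    ∑ i, ε i • Literature.NumberTheory.Transcendental.KZ.of (ρ i) with hS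
  set S' : Literature.NumberTheory.Transcendental.KZ.FormalRep :=
    ∑ j, ε' j • Literature.NumberTheory.Transcendental.KZ.of (ρ' j) with hS'
  -- S - S' lies in the resolved sector
  have hmem : S - S' ∈ AddSubgroup.closure
      {x : Literature.NumberTheory.Transcendental.KZ.FormalRep |
        ∃ (n : ℕ) (ρ : Literature.NumberTheory.Transcendental.KZ.IntegralRep n),
          Bornology.IsBounded ρ.domain ∧
          (∃ U : Set (Fin n → ℝ), IsOpen U ∧ closure ρ.domain ⊆ U ∧ ContDiffOn ℝ 1 ρ.integrand U) ∧
          x = Literature.NumberTheory.Transcendental.KZ.of ρ} := by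
    refine sub_mem (sum_mem fun i _ => AddSubgroup.zsmul_mem _ ?_ _)
      (sum_mem fun j _ => AddSubgroup.zsmul_mem _ ?_ _)
    · exact AddSubgroup.subset_closure ⟨n, ρ i, (hρ i).1, (hρ i).2, rfl⟩
    · exact AddSubgroup.subset_closure ⟨m, ρ' j, (hρ' j).1, (hρ' j).2, rfl⟩
  -- and evaluates to zero, by soundness of the moves and r.value = r'.value
  have hker := Literature.NumberTheory.Transcendental.KZ.relations_le_ker_eval_holds hrel
  have hker' := Literature.NumberTheory.Transcendental.KZ.relations_le_ker_eval_holds hrel'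
  rw [AddMonoidHom.mem_ker, map_sub, Literature.NumberTheory.Transcendental.KZ.eval_of] at hker hker'
  have heval : Literature.NumberTheory.Transcendental.KZ.eval (S - S') = 0 := by
    rw [map_sub]; linarith
  -- so a non-zero multiple of it is a relation, hence it is a relation
  obtain ⟨M, hM, hMc⟩ := h₂ _ hmem heval
  have hc : S - S' ∈ Literature.NumberTheory.Transcendental.KZ.relations := h₃ M _ hM hMc
  -- reassemble [r] - [r']
  have hsplit : Literature.NumberTheory.Transcendental.KZ.of r - Literature.NumberTheory.Transcendental.KZ.of r' =
      (Literature.NumberTheory.Transcendental.KZ.of r - S) + (S - S') -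
        (Literature.NumberTheory.Transcendental.KZ.of r' - S') := by abel
  show Literature.NumberTheory.Transcendental.KZ.of r - Literature.NumberTheory.Transcendental.KZ.of r' ∈
    Literature.NumberTheory.Transcendental.KZ.relations
  rw [hsplit]
  exact sub_mem (add_mem hrel hc) hrel'

end Summit.KontsevichZagierPeriods.KontsevichZagierPeriods.Theses.VeryGoodTransfer
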